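import Literature.Geometry.Riemannian.HamiltonODEMinPrinciple
import Literature.Geometry.Riemannian.PinchingEstimatesMinimisers
import Literature.Geometry.Riemannian.PinchingEstimatesODE
import Literature.Geometry.Riemannian.PinchingEstimatesTwoSmallestSum
import Mathlib.Analysis.Normed.Module.FiniteDimension
import HarnessLib

/-!
# Hamilton 1997, Thms. 1.2 and 1.6 at the level of the curvature ODE — proved
(topic `Geometry/Riemannian`)

Part of the decomposition of `Literature.Geometry.Riemannian.hamilton_chenZhu_pinching`
(`PinchingEstimates.lean`): the per-block ODE statements of Hamilton 1997, Thms. 1.2 and 1.6, in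
the shape used by the family `HamiltonODE.pinchingFamily` (`PinchingFamily.lean`) and intended
for the forthcoming assembly of Chen–Zhu's Lemma 2.1, are PROVED here:

* `isInvariantRel_twoSmallest_fst` / `_snd` — **Thm. 1.2** (Hamilton 1997, p. 7: "For any
  constant `m > 0` the Ricci flow preserves the inequalities `a₁ + a₂ ≥ m` and `c₁ + c₂ ≥ m`"),
  ODE part: relative to the phase space `{A, C symmetric}`, `{a₁ + a₂ ≥ m}` and `{c₁ + c₂ ≥ m}`
  are each forward invariant under Hamilton's ODE (`HamiltonODE.field`). The joint form
  `isInvariantRel_twoSmallestEigenvaluesSumGE` of `PinchingEstimatesTwoSmallestSum.lean` (proved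
  there by a first-bad-time argument) follows from these two in one line
  (`IsInvariantRel.inter`); the per-block statements are formally stronger and are obtained here
  by a second route;
* `isInvariantRel_smallestAddNonneg_fst` / `_snd` — **Thm. 1.6** (p. 10: "For any constant `ρ`
  the estimates `a₁ + ρ > 0` and `c₁ + ρ > 0` are preserved"), ODE part, closed form:
  `{a₁ + ρ ≥ 0}` is forward invariant relative to `{A, C symmetric, a₁ + a₂ ≥ m}` (`m > 0`), and
  likewise for `C`.

Proof: `a₁ + a₂ = min {uᵀAu + vᵀAv}` over orthonormal pairs and `a₁ = min {uᵀAu}` over unit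
vectors are minima of linear functions of `A` over compact parameter sets, so Hamilton's Lipschitz
calculus applies (`HamiltonODE.minOver_ge_of_deriv`, `HamiltonODEMinPrinciple.lean`; Hamilton
1986, Lemmas 3.1, 3.5), the differential inequality at the minimisers being Hamilton 1986,
Lemma 6.1 in the variational form of `PinchingEstimatesMinimisers.lean`
(`field_pairSum_nonneg_of_min`, `field_quad_nonneg_of_min`).

## References

* R. S. Hamilton, *Four-manifolds with positive isotropic curvature*, Comm. Anal. Geom. 5 (1997)
  1–92, §2.1, Thm. 1.2 (p. 7) and Thm. 1.6 (p. 10). [Hamilton1997]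
* R. S. Hamilton, J. Differential Geom. 24 (1986), §3 (Lemmas 3.1, 3.5) and §6 (Lemma 6.1). [Hamilton1986]
-/

noncomputable section

open Set Real
open scoped Matrix BigOperators Topology

namespace Literature.Geometry.Riemannian

namespace HamiltonODE

/-! ### The compact parameter sets: unit vectors and orthonormal pairs of `ℝ³` -/

/-- The unit sphere of `ℝ³` (dot-product normalisation). [folklore] -/
def unitSet : Set (Fin 3 → ℝ) := {u | u ⬝ᵥ u = 1}

/-- The orthonormal pairs of `ℝ³`. [folklore] -/
def pairSet : Set ((Fin 3 → ℝ) × (Fin 3 → ℝ)) :=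
  {q | q.1 ⬝ᵥ q.1 = 1 ∧ q.2 ⬝ᵥ q.2 = 1 ∧ q.1 ⬝ᵥ q.2 = 0}

/-- Coefficients of the quadratic form `uᵀMu` as a linear function of `M`. [folklore] -/
def quadCoeff (k l : Fin 3) (u : Fin 3 → ℝ) : ℝ := u k * u l

/-- Coefficients of `uᵀMu + vᵀMv` as a linear function of `M`. [folklore] -/
def pairCoeff (k l : Fin 3) (q : (Fin 3 → ℝ) × (Fin 3 → ℝ)) : ℝ := q.1 k * q.1 l + q.2 k * q.2 l

/-- `Σ M_{kl} u_k u_l = uᵀMu`. [folklore] -/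
theorem linComb_quadCoeff (M : Matrix (Fin 3) (Fin 3) ℝ) (u : Fin 3 → ℝ) :
    linComb quadCoeff M u = u ⬝ᵥ (M *ᵥ u) := by
  simp only [linComb, quadCoeff, dotProduct, Matrix.mulVec, Finset.mul_sum]
  exact Finset.sum_congr rfl fun k _ ↦ Finset.sum_congr rfl fun l _ ↦ by ring

/-- `Σ M_{kl} (u_k u_l + v_k v_l) = uᵀMu + vᵀMv`. [folklore] -/
theorem linComb_pairCoeff (M : Matrix (Fin 3) (Fin 3) ℝ) (q : (Fin 3 → ℝ) × (Fin 3 → ℝ)) :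
    linComb pairCoeff M q = q.1 ⬝ᵥ (M *ᵥ q.1) + q.2 ⬝ᵥ (M *ᵥ q.2) := by
  simp only [linComb, pairCoeff, dotProduct, Matrix.mulVec, Finset.mul_sum, ← Finset.sum_add_distrib]
  exact Finset.sum_congr rfl fun k _ ↦ Finset.sum_congr rfl fun l _ ↦ by ring

/-- The unit sphere is compact. [folklore] -/
theorem isCompact_unitSet : IsCompact unitSet := by
  refine Metric.isCompact_of_isClosed_isBounded ?_ ?_
  · exact isClosed_eq (Continuous.dotProduct continuous_id continuous_id) continuous_const
  · exact (Metric.isBounded_closedBall (x := (0 : Fin 3 → ℝ)) (r := 1)).subset fun u hu ↦ by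
      simpa using norm_le_one_of_dotProduct_self hu

/-- The set of orthonormal pairs is compact (`isCompact_orthonormalPairs` of
`PinchingEstimatesTwoSmallestSum.lean`). [folklore] -/
theorem isCompact_pairSet : IsCompact pairSet := isCompact_orthonormalPairs

/-- The unit sphere is nonempty. [folklore] -/
theorem unitSet_nonempty : unitSet.Nonempty := ⟨![1, 0, 0], by simp [unitSet, dotProduct, Fin.sum_univ_three]⟩

/-- There are orthonormal pairs. [folklore] -/
theorem pairSet_nonempty : pairSet.Nonempty :=
  ⟨(![1, 0, 0], ![0, 1, 0]), by simp [pairSet, dotProduct, Fin.sum_univ_three]⟩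

/-- The coefficients are continuous. [folklore] -/
theorem continuous_quadCoeff (k l : Fin 3) : Continuous (quadCoeff k l) :=
  (continuous_apply k).mul (continuous_apply l)

/-- The coefficients are continuous. [folklore] -/
theorem continuous_pairCoeff (k l : Fin 3) : Continuous (pairCoeff k l) :=
  (((continuous_apply k).comp continuous_fst).mul ((continuous_apply l).comp continuous_fst)).add
    (((continuous_apply k).comp continuous_snd).mul ((continuous_apply l).comp continuous_snd))

/-- Entries of a dot-normalised vector are bounded by `1`. [folklore] -/
theorem abs_apply_le_one_of_dot_self {u : Fin 3 → ℝ} (hu : u ⬝ᵥ u = 1) (k : Fin 3) : |u k| ≤ 1 := by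
  simpa [Real.norm_eq_abs] using (norm_le_pi_norm u k).trans (norm_le_one_of_dotProduct_self hu)

/-- `|u_k u_l| ≤ 1` on the unit sphere. [folklore] -/
theorem abs_quadCoeff_le {u : Fin 3 → ℝ} (hu : u ∈ unitSet) (k l : Fin 3) : |quadCoeff k l u| ≤ 1 := by
  rw [quadCoeff, abs_mul]
  exact mul_le_one₀ (abs_apply_le_one_of_dot_self hu k) (abs_nonneg _)
    (abs_apply_le_one_of_dot_self hu l)

/-- `|u_k u_l + v_k v_l| ≤ 2` on orthonormal pairs. [folklore] -/
theorem abs_pairCoeff_le {q : (Fin 3 → ℝ) × (Fin 3 → ℝ)} (hq : q ∈ pairSet) (k l : Fin 3) :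
    |pairCoeff k l q| ≤ 2 := by
  rw [pairCoeff]
  refine (abs_add_le _ _).trans ?_
  rw [abs_mul, abs_mul]
  have := mul_le_one₀ (abs_apply_le_one_of_dot_self hq.1 k) (abs_nonneg _)
    (abs_apply_le_one_of_dot_self hq.1 l)
  have := mul_le_one₀ (abs_apply_le_one_of_dot_self hq.2.1 k) (abs_nonneg _)
    (abs_apply_le_one_of_dot_self hq.2.1 l)
  linarith

/-- `a₁ + ρ ≥ 0` as a bound on the minimum over the unit sphere. [folklore] -/
theorem smallestEigenvalueAddNonneg_iff (M : Matrix (Fin 3) (Fin 3) ℝ) (ρ : ℝ) :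
    M.SmallestEigenvalueAddNonneg ρ ↔ -ρ ≤ minOver quadCoeff unitSet M := by
  rw [le_minOver_iff isCompact_unitSet unitSet_nonempty continuous_quadCoeff]
  simp only [linComb_quadCoeff, unitSet, mem_setOf_eq, Matrix.SmallestEigenvalueAddNonneg]
  exact ⟨fun h u hu ↦ by linarith [h u hu], fun h u hu ↦ by linarith [h u hu]⟩

/-- `a₁ + a₂ ≥ m` as a bound on the minimum over orthonormal pairs. [folklore] -/
theorem twoSmallestEigenvaluesSumGE_iff (M : Matrix (Fin 3) (Fin 3) ℝ) (m : ℝ) :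
    M.TwoSmallestEigenvaluesSumGE m ↔ m ≤ minOver pairCoeff pairSet M := by
  rw [le_minOver_iff isCompact_pairSet pairSet_nonempty continuous_pairCoeff]
  simp only [linComb_pairCoeff, pairSet, mem_setOf_eq, Matrix.TwoSmallestEigenvaluesSumGE]
  exact ⟨fun h q hq ↦ h q.1 q.2 hq.1 hq.2.1 hq.2.2, fun h u v hu hv huv ↦ h (u, v) ⟨hu, hv, huv⟩⟩

/-! ### The differential inequalities at the minimisers -/

/-- The normalised great-circle variation of a unit vector towards an orthogonal unit vector
stays on the sphere and stays orthogonal to any vector orthogonal to both. [folklore] -/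
theorem variation_mem {u w : Fin 3 → ℝ} (hu : u ⬝ᵥ u = 1) (hw : w ⬝ᵥ w = 1) (huw : u ⬝ᵥ w = 0)
    (t : ℝ) : ((1 + t ^ 2)⁻¹.sqrt • (u + t • w)) ⬝ᵥ ((1 + t ^ 2)⁻¹.sqrt • (u + t • w)) = 1 := by
  have ht : 0 < 1 + t ^ 2 := by positivity
  rw [dotProduct_smul, smul_dotProduct, smul_eq_mul, smul_eq_mul, norm_sq_add_smul hu hw huw,
    Real.sqrt_inv, ← mul_assoc, ← mul_inv, Real.mul_self_sqrt ht.le, inv_mul_cancel₀ ht.ne']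

/-- **Thm. 1.2 at the minimiser**: for symmetric `A`, any `B`, and an orthonormal pair minimising
`uᵀAu + vᵀAv` over orthonormal pairs with positive value, Hamilton's `uᵀA'u + vᵀA'v ≥ 0`.
[cite: Hamilton1997, §2.1, Thm. 1.2 (proof, p. 7)] -/
theorem pairSum_field_nonneg_of_isMinOn {A B : Matrix (Fin 3) (Fin 3) ℝ} (hA : A.IsSymm)
    {q : (Fin 3 → ℝ) × (Fin 3 → ℝ)} (hq : q ∈ pairSet)
    (hmin : IsMinOn (linComb pairCoeff A) pairSet q) (hpos : 0 < linComb pairCoeff A q) :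
    0 ≤ linComb pairCoeff (A * A + B * Bᵀ + (2 : ℝ) • A.sharp) q := by
  obtain ⟨u, v⟩ := q
  obtain ⟨hu, hv, huv⟩ := hq
  set w := u ⨯₃ v with hw
  have hw1 : w ⬝ᵥ w = 1 := dotProduct_cross_self_of_orthonormal hu hv huv
  have huw : u ⬝ᵥ w = 0 := dot_self_cross u v
  have hvw : v ⬝ᵥ w = 0 := dot_cross_self u v
  rw [linComb_pairCoeff] at hpos ⊢
  refine field_pairSum_nonneg_of_min hA hu hv hw1 huv huw hvw (fun t ↦ ?_) (fun t ↦ ?_) hpos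
  · have hmem : ((1 + t ^ 2)⁻¹.sqrt • (u + t • w), v) ∈ pairSet := by
      refine ⟨variation_mem hu hw1 huw t, hv, ?_⟩
      simp [smul_dotProduct, add_dotProduct, huv, dotProduct_comm w v, hvw]
    have h := hmin hmem
    rw [mem_setOf_eq, linComb_pairCoeff, linComb_pairCoeff] at h
    simpa using h
  · have hmem : (u, (1 + t ^ 2)⁻¹.sqrt • (v + t • w)) ∈ pairSet := by
      refine ⟨hu, variation_mem hv hw1 hvw t, ?_⟩
      simp [dotProduct_smul, dotProduct_add, huv, huw]
    have h := hmin hmem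
    rw [mem_setOf_eq, linComb_pairCoeff, linComb_pairCoeff] at h
    simpa using h

/-- **Thm. 1.6 at the minimiser**: for symmetric `A` with `a₁ + a₂ ≥ m > 0`, any `B`, and a unit
vector minimising `uᵀAu`, Hamilton's `uᵀA'u ≥ 0`. [cite: Hamilton1997, §2.1, Thm. 1.6 (proof, p. 10)] -/
theorem quad_field_nonneg_of_isMinOn {A B : Matrix (Fin 3) (Fin 3) ℝ} (hA : A.IsSymm) {m : ℝ}
    (hm : 0 < m) (hpair : A.TwoSmallestEigenvaluesSumGE m) {u : Fin 3 → ℝ} (hu : u ∈ unitSet)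
    (hmin : IsMinOn (linComb quadCoeff A) unitSet u) :
    0 ≤ linComb quadCoeff (A * A + B * Bᵀ + (2 : ℝ) • A.sharp) u := by
  rw [linComb_quadCoeff]
  refine field_quad_nonneg_of_min hA hm hpair hu fun z hz ↦ ?_
  have h := hmin (show z ∈ unitSet from hz)
  rwa [mem_setOf_eq, linComb_quadCoeff, linComb_quadCoeff] at h

/-! ### Thm. 1.2 and Thm. 1.6, ODE parts -/

/-- **Hamilton 1997, Thm. 1.2, ODE part, for the block `A` (proved)**: for `m > 0`,
`{a₁ + a₂ ≥ m}` is forward invariant under Hamilton's ODE relative to `{A, C symmetric}`.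
[cite: Hamilton1997, §2.1, Thm. 1.2 (p. 7)] -/
theorem isInvariantRel_twoSmallest_fst {m : ℝ} (hm : 0 < m) :
    IsInvariantRel field (fun _ ↦ {p : Blocks | p.1.IsSymm ∧ p.2.2.IsSymm})
      (fun _ ↦ {p | p.1.TwoSmallestEigenvaluesSumGE m}) := by
  intro γ t₀ t₁ _ h₁ hγ hK hin
  rw [mem_setOf_eq, twoSmallestEigenvaluesSumGE_iff] at hin ⊢
  refine minOver_ge_of_deriv isCompact_pairSet pairSet_nonempty continuous_pairCoeff
    (fun q hq ↦ abs_pairCoeff_le hq) (A := fun s ↦ (γ s).1) (A' := fun s ↦ (field (γ s)).1) h₁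
    (fun s hs k l ↦ (hγ s hs).1 k l) hm (fun s hs hθ q hq hqmin ↦ ?_) hin
  rw [field_fst]
  refine pairSum_field_nonneg_of_isMinOn (hK s (Ico_subset_Icc_self hs)).1 hq hqmin ?_
  exact hθ.trans_le (minOver_le isCompact_pairSet pairSet_nonempty continuous_pairCoeff _ hq)

/-- **Hamilton 1997, Thm. 1.2, ODE part, for the block `C` (proved)** ("`C` is the same").
[cite: Hamilton1997, §2.1, Thm. 1.2 (p. 7)] -/
theorem isInvariantRel_twoSmallest_snd {m : ℝ} (hm : 0 < m) :
    IsInvariantRel field (fun _ ↦ {p : Blocks | p.1.IsSymm ∧ p.2.2.IsSymm})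
      (fun _ ↦ {p | p.2.2.TwoSmallestEigenvaluesSumGE m}) := by
  intro γ t₀ t₁ _ h₁ hγ hK hin
  rw [mem_setOf_eq, twoSmallestEigenvaluesSumGE_iff] at hin ⊢
  refine minOver_ge_of_deriv isCompact_pairSet pairSet_nonempty continuous_pairCoeff
    (fun q hq ↦ abs_pairCoeff_le hq) (A := fun s ↦ (γ s).2.2) (A' := fun s ↦ (field (γ s)).2.2) h₁
    (fun s hs k l ↦ (hγ s hs).2.2 k l) hm (fun s hs hθ q hq hqmin ↦ ?_) hin
  rw [field_snd_snd]
  refine pairSum_field_nonneg_of_isMinOn (hK s (Ico_subset_Icc_self hs)).2 hq hqmin ?_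
  exact hθ.trans_le (minOver_le isCompact_pairSet pairSet_nonempty continuous_pairCoeff _ hq)

/-- **Hamilton 1997, Thm. 1.6, ODE part, for the block `A` (proved)**: for `m > 0` and any real
`ρ`, `{a₁ + ρ ≥ 0}` is forward invariant relative to `{A, C symmetric} ∩ {a₁ + a₂ ≥ m}`.
[cite: Hamilton1997, §2.1, Thm. 1.6 (p. 10)] -/
theorem isInvariantRel_smallestAddNonneg_fst {m : ℝ} (hm : 0 < m) (ρ : ℝ) :
    IsInvariantRel field
      (fun _ ↦ {p : Blocks | (p.1.IsSymm ∧ p.2.2.IsSymm) ∧ p.1.TwoSmallestEigenvaluesSumGE m})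
      (fun _ ↦ {p | p.1.SmallestEigenvalueAddNonneg ρ}) := by
  intro γ t₀ t₁ _ h₁ hγ hK hin
  rw [mem_setOf_eq, smallestEigenvalueAddNonneg_iff] at hin ⊢
  refine minOver_ge_of_deriv isCompact_unitSet unitSet_nonempty continuous_quadCoeff
    (fun u hu ↦ abs_quadCoeff_le hu) (A := fun s ↦ (γ s).1) (A' := fun s ↦ (field (γ s)).1) h₁
    (fun s hs k l ↦ (hγ s hs).1 k l) (θ := -ρ - 1) (by linarith) (fun s hs _ u hu humin ↦ ?_) hin
  rw [field_fst]
  obtain ⟨⟨hsA, -⟩, hpair⟩ := hK s (Ico_subset_Icc_self hs)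
  exact quad_field_nonneg_of_isMinOn hsA hm hpair hu humin

/-- **Hamilton 1997, Thm. 1.6, ODE part, for the block `C` (proved)**.
[cite: Hamilton1997, §2.1, Thm. 1.6 (p. 10)] -/
theorem isInvariantRel_smallestAddNonneg_snd {m : ℝ} (hm : 0 < m) (ρ : ℝ) :
    IsInvariantRel field
      (fun _ ↦ {p : Blocks | (p.1.IsSymm ∧ p.2.2.IsSymm) ∧ p.2.2.TwoSmallestEigenvaluesSumGE m})
      (fun _ ↦ {p | p.2.2.SmallestEigenvalueAddNonneg ρ}) := by
  intro γ t₀ t₁ _ h₁ hγ hK hin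
  rw [mem_setOf_eq, smallestEigenvalueAddNonneg_iff] at hin ⊢
  refine minOver_ge_of_deriv isCompact_unitSet unitSet_nonempty continuous_quadCoeff
    (fun u hu ↦ abs_quadCoeff_le hu) (A := fun s ↦ (γ s).2.2) (A' := fun s ↦ (field (γ s)).2.2) h₁
    (fun s hs k l ↦ (hγ s hs).2.2 k l) (θ := -ρ - 1) (by linarith) (fun s hs _ u hu humin ↦ ?_) hin
  rw [field_snd_snd]
  obtain ⟨⟨-, hsC⟩, hpair⟩ := hK s (Ico_subset_Icc_self hs)
  exact quad_field_nonneg_of_isMinOn hsC hm hpair hu humin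

end HamiltonODE

end Literature.Geometry.Riemannian

end
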